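import Literature.AnabelianGeometry.AbsoluteAnabelian.AbsTopIProp23iGFGSurfaceModel
import Literature.AnabelianGeometry.AbsoluteAnabelian.AbsTopIProp23AlmostProSigmaFNIffOuterFaithful
import Literature.AnabelianGeometry.AbsoluteAnabelian.ProfiniteIndexTwoInversionSlim
import Literature.GroupTheory.CombinatorialGroupTheory.SurfaceGroupAbelianizationFaithful
import HarnessLib

/-!
# [AbsTopI] Prop 2.3 (i): outer-faithfulness of the deck group from its action on HOMOLOGY

S. Mochizuki, *Topics in Absolute Anabelian Geometry I: Generalities* (2012) [AbsTopI] (lit key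
`paper:url-11ac98ba15fc`), Def 2.1 (i) p. 17 (GFG-type: `X` a hyperbolic orbicurve — "a geometrically
connected, smooth, separated algebraic STACK", `Y → X` finite étale Galois with `Y` a CURVE,
`Δ_X ⊇ Ker(Δ_X → Gal(Y/X)) = Δ_Y^Σ`), Prop 2.3 (i) p. 19 ("`Δ` is slim and elastic").

abc-iut cell, seat abc-iut-f-051 (gen 4); PROOF-ONLY (no definition, no named fact).  The tree proves
Prop 2.3 (i) for the almost pro-`Σ` `Δ` from the ONE residual input (OF) «`Δ/U ↪ Out U`» (⟺ (FN);
`AbsTopIProp23AlmostProSigmaOuterFaithfulTF`, `…FNIffOuterFaithful`) and DISCHARGES (OF) at the Def 2.1 (i)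
construction for proper and affine CURVES (p440186, p443001: slimness + free pro-`ℓ` rank rigidity).  THIS
FILE gives the HOMOLOGICAL route — how geometry sees (OF) — which is ready for ORBICURVES:

* `outerFaithful_of_forall_exists_conj_not_mem_commutator` — **(H_ab) ⇒ (OF)**: if every `x ∈ Δ ∖ U`
  moves a class of `U^{ab} = U/[U,U]`, then no `x ∈ Δ ∖ U` acts on `U` as an inner automorphism (inner
  automorphisms fix `U^{ab}`);
* `forall_exists_conj_not_mem_closure_commutator_of_denseRange` — **DENSE-LATTICE CRITERION**: `Δ` a
  compact group, `U ⊴ Δ` open, `j : Λ → Δ` with dense image such that `j| : j⁻¹U → U` is a pro-`Σ`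
  completion, and (HOM) every `λ ∈ Λ ∖ j⁻¹U` is detected by a character `j⁻¹U → ℤ/n` (`n` a
  `Σ`-integer) — «`Λ/j⁻¹U = Δ/U` acts faithfully on `H₁(j⁻¹U, ℤ_Σ)`» — then every `x ∈ Δ ∖ U` moves a class
  of `U/closure[U,U]`;
* `GFGSurfaceModel.centralizer_map_eq_bot_of_homological` (+ `…forall_finite_normal_eq_bot_of_homological`,
  `…slim_and_elastic_of_homological`) — at the Def 2.1 (i) GFG construction of the tree (`P` a pro-`Σ′`
  completion `j : Γ → P` of an ARBITRARY discrete `Γ` — a Fuchsian lattice of an orbicurve allowed —,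
  `U ⊴ P` open with `j⁻¹U ≅ Γ_{g,r}` hyperbolic, `π : P ↠ D` presenting the maximal pro-`Σ` quotient on
  `U`): (HOM) «every `γ ∈ Γ ∖ j⁻¹U` moves a class of `H₁(j⁻¹U, ℤ)`» ⇒ **(T1) `Z_D(π U) = 1`, (T3) no finite
  normal subgroups, (T4) `D` slim and elastic**;
* `GFGSurfaceModel.slim_and_elastic_of_puncturedSurfaceGroup_lattice` — CURVE case `Γ = Γ_{g₀,r₀}`
  hyperbolic (proper and affine alike): (HOM) is the THEOREM
  `PuncturedSurfaceGroup.exists_conj_not_mem_commutator` (Schreier / F_cov rank growth), so (T1)/(T3)/(T4)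
  hold outright — an INDEPENDENT second route to p440186/p443001;
* `outerFaithful_of_indexTwoInv` — the index-two inversion model of this lineage (p437009) as a special case.

HONEST SCOPE: model-level.  For an ORBICURVE `X = [Y/Gal(Y/X)]` the residual at the Def 2.1 (i)
construction becomes the classical homological input (HOM) «a nontrivial automorphism of finite order of a
hyperbolic Riemann surface of finite type moves a class of `H₁(Y, ℤ)`» (Hurwitz; Serre's rigidity lemma)
for the Fuchsian lattice `Γ = π₁^{orb}(X)` — an explicit binder (Fuchsian presentations are not in the
tree; no definition, no new fact).  Classical (pro)finite group theory; OUR kernel check; nothing here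
bears on [IUTchIII] Cor. 3.12; no side is taken; typed ≠ proved elsewhere.
-/

noncomputable section

open Topology

universe u

namespace Literature.AnabelianGeometry.AbsoluteAnabelian

open Literature.AlgebraicGeometry.Frobenioids (IsSlimGroup)
open Literature.AnabelianGeometry.Anabelioids (IsSigmaInteger)
open Literature.AnabelianGeometry.SemiGraphs.SemiGraphOfAnabelioids
open Literature.AnabelianGeometry.SemiGraphs.SemiGraphOfAnabelioids.IsProSigmaCompletion
open Literature.GroupTheory.CombinatorialGroupTheory

/-! ### (H_ab) ⇒ (OF) -/

section Homological

variable {G : Type u} [Group G]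

/-- **(H_ab) ⇒ (OF).**  If every `x ∉ U` moves a class of `U^{ab}` — some `y ∈ U` has
`x y x⁻¹ y⁻¹ ∉ [U, U]` — then an `x` acting on `U` as an inner automorphism of `U` lies in `U` (for
`x y x⁻¹ = u y u⁻¹` gives `x y x⁻¹ y⁻¹ = u y u⁻¹ y⁻¹ ∈ [U, U]`). [cite: MochizukiAbsTopI2012, Prop 2.3 (i) p.19] -/
theorem outerFaithful_of_forall_exists_conj_not_mem_commutator (U : Subgroup G)
    (hab : ∀ x : G, x ∉ U → ∃ y ∈ U, x * y * x⁻¹ * y⁻¹ ∉ ⁅U, U⁆) :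
    ∀ x : G, (∃ u ∈ U, ∀ y ∈ U, x * y * x⁻¹ = u * y * u⁻¹) → x ∈ U := by
  intro x ⟨u, hu, hux⟩
  by_contra hx
  obtain ⟨y, hy, hxy⟩ := hab x hx
  apply hxy
  rw [hux y hy, ← commutatorElement_def]
  exact Subgroup.commutator_mem_commutator hu hy

variable [TopologicalSpace G] [IsTopologicalGroup G]

/-- The closed form: moving a class of `U/closure[U,U]` moves a class of `U/[U,U]`.
[cite: MochizukiAbsTopI2012, Prop 2.3 (i) p.19] -/
theorem outerFaithful_of_forall_exists_conj_not_mem_closure_commutator (U : Subgroup G)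
    (hab : ∀ x : G, x ∉ U → ∃ y ∈ U,
      x * y * x⁻¹ * y⁻¹ ∉ ((⁅U, U⁆ : Subgroup G)).topologicalClosure) :
    ∀ x : G, (∃ u ∈ U, ∀ y ∈ U, x * y * x⁻¹ = u * y * u⁻¹) → x ∈ U :=
  outerFaithful_of_forall_exists_conj_not_mem_commutator U fun x hx => by
    obtain ⟨y, hy, hxy⟩ := hab x hx
    exact ⟨y, hy, fun h => hxy (Subgroup.le_topologicalClosure _ h)⟩

end Homological

/-! ### The dense-lattice criterion -/

section Lattice

variable {G : Type u} [Group G] [TopologicalSpace G] [IsTopologicalGroup G] [CompactSpace G]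
  [TotallyDisconnectedSpace G] {Λ : Type*} [Group Λ] {j : Λ →* G} {Sigma : Set ℕ}

/-- **DENSE-LATTICE CRITERION for (H_ab).**  Let `G` be a profinite group, `U ⊴ G` open, `j : Λ → G`
a homomorphism with dense image from a discrete group such that the restriction `j| : j⁻¹U → U` is a
pro-`Σ` completion, and suppose (HOM): every `λ ∈ Λ ∖ j⁻¹U` is detected on a finite `Σ`-quotient of
`(j⁻¹U)^{ab}` — there are a `Σ`-integer `n`, a character `χ : j⁻¹U → ℤ/n` and `h ∈ j⁻¹U` with
`χ(λ h λ⁻¹) ≠ χ(h)`.  Then every `x ∈ G ∖ U` moves a class of `U/closure[U,U]`.  (The coset `xU` contains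
some `j λ`, `λ ∉ j⁻¹U`; `χ` extends to a continuous `F : U → ℤ/n` killing `closure[U,U]`, and
`F(x·jh·x⁻¹·jh⁻¹) = χ(λhλ⁻¹) χ(h)⁻¹ ≠ 1`.) [cite: MochizukiAbsTopI2012, Prop 2.3 (i) p.19] -/
theorem forall_exists_conj_not_mem_closure_commutator_of_denseRange (hj : Dense (Set.range j))
    (U : Subgroup G) [hUn : U.Normal] (hUo : IsOpen (U : Set G))
    (hU : IsProSigmaCompletion Sigma (j.subgroupComap U))
    (hHom : ∀ l : Λ, l ∉ U.comap j → ∃ (n : ℕ) (χ : U.comap j →* Multiplicative (ZMod n))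
      (h : U.comap j), IsSigmaInteger Sigma n ∧
        χ ⟨l * h * l⁻¹, by
          have := hUn.comap j
          exact this.conj_mem _ h.2 l⟩ ≠ χ h) :
    ∀ x : G, x ∉ U → ∃ y ∈ U, x * y * x⁻¹ * y⁻¹ ∉ ((⁅U, U⁆ : Subgroup G)).topologicalClosure := by
  classical
  intro x hx
  haveI : CompactSpace U := Literature.GroupTheory.ProfiniteSubquotients.compactSpace_of_isOpen hUo
  -- the open coset `x U` meets the dense image of `Λ`: `j l = x * u₀`
  obtain ⟨l, u₀, hu₀, hl⟩ : ∃ (l : Λ) (u₀ : G), u₀ ∈ U ∧ j l = x * u₀ := by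
    have hopen : IsOpen ((Homeomorph.mulLeft x) '' (U : Set G)) := (Homeomorph.mulLeft x).isOpenMap _ hUo
    obtain ⟨_, ⟨u₀, hu₀, rfl⟩, ⟨l, hl⟩⟩ := hj.inter_open_nonempty _ hopen ⟨x, ⟨1, U.one_mem, by simp⟩⟩
    exact ⟨l, u₀, hu₀, hl⟩
  have hlU : l ∉ U.comap j := by
    intro h
    rw [Subgroup.mem_comap, hl] at h
    exact hx ((Subgroup.mul_mem_cancel_right U hu₀).mp h)
  obtain ⟨n, χ, h, hn, hχ⟩ := hHom l hlU
  -- extend `χ` continuously to `U`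
  haveI : NeZero n := ⟨hn.1.ne'⟩
  letI : TopologicalSpace (Multiplicative (ZMod n)) := ⊥
  haveI : DiscreteTopology (Multiplicative (ZMod n)) := ⟨rfl⟩
  haveI : Finite (Multiplicative (ZMod n)) := Finite.of_equiv _ Multiplicative.ofAdd
  have hcard : IsSigmaInteger Sigma (Nat.card (Multiplicative (ZMod n))) := by
    rwa [Nat.card_congr Multiplicative.toAdd, Nat.card_zmod]
  obtain ⟨F, hFc, hF⟩ := exists_continuous_extend_top hU hcard χ
  -- `F` kills the closed commutator subgroup of `U`
  have hkerc : IsClosed ((F.ker : Subgroup U) : Set U) := by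
    rw [MonoidHom.coe_ker]
    exact (isClosed_discrete _).preimage hFc
  have hker : (commutator U).topologicalClosure ≤ F.ker :=
    Subgroup.topologicalClosure_minimal _ (Abelianization.commutator_subset_ker F) hkerc
  -- the witness `y := j h`
  have hyU : j (h : Λ) ∈ U := h.2
  refine ⟨j (h : Λ), hyU, fun hmem => hχ ?_⟩
  -- `x y x⁻¹ y⁻¹ ∈ U` and, seen in `U`, in the closure of `[U, U]`
  have hcU : x * j (h : Λ) * x⁻¹ * (j (h : Λ))⁻¹ ∈ U :=
    U.mul_mem (hUn.conj_mem _ hyU x) (U.inv_mem hyU)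
  have hmem' : (⟨_, hcU⟩ : U) ∈ (commutator U).topologicalClosure := by
    rw [mem_topologicalClosure_commutator_iff]
    exact hmem
  have h1 : F ⟨_, hcU⟩ = 1 := hker hmem'
  -- compute `F` on the commutator: `x = j l · u₀⁻¹`
  have hxe : x = j l * u₀⁻¹ := by rw [hl, mul_inv_cancel_right]
  have hlhl : j (l * h * l⁻¹) ∈ U := (hUn.comap j).conj_mem _ h.2 l
  have ha : j l * u₀⁻¹ * (j l)⁻¹ ∈ U := hUn.conj_mem _ (U.inv_mem hu₀) _
  -- `x·jh·x⁻¹ = a · j(l h l⁻¹) · a⁻¹` with `a := j l · u₀⁻¹ · (j l)⁻¹ ∈ U`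
  have hconj : (⟨x * j (h : Λ) * x⁻¹, hUn.conj_mem _ hyU x⟩ : U) =
      ⟨j l * u₀⁻¹ * (j l)⁻¹, ha⟩ * ⟨j (l * h * l⁻¹), hlhl⟩ * ⟨j l * u₀⁻¹ * (j l)⁻¹, ha⟩⁻¹ := by
    apply Subtype.ext
    simp only [Subgroup.coe_mul, Subgroup.coe_inv, map_mul, map_inv, hxe]
    group
  have hFconj : F ⟨x * j (h : Λ) * x⁻¹, hUn.conj_mem _ hyU x⟩ = χ ⟨l * h * l⁻¹, hlhl⟩ := by
    rw [hconj, map_mul, map_mul, map_inv, mul_inv_cancel_comm, ← hF]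
    rfl
  have hFy : F ⟨j (h : Λ), hyU⟩ = χ h := by
    rw [← hF]
    rfl
  have hsplit : (⟨_, hcU⟩ : U) =
      ⟨x * j (h : Λ) * x⁻¹, hUn.conj_mem _ hyU x⟩ * ⟨j (h : Λ), hyU⟩⁻¹ := Subtype.ext rfl
  rw [hsplit, map_mul, map_inv, hFconj, hFy, mul_inv_eq_one] at h1
  exact h1

end Lattice

/-! ### The GFG construction of Def 2.1 (i) with an arbitrary lattice: (T1)–(T4) from (HOM) -/

namespace GFGSurfaceModel

open Literature.AnabelianGeometry.SemiGraphs.PSCDatum (IsMaxProSigmaQuotient)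
open Literature.GroupTheory.ProfiniteSubquotients

variable {Sigma Sigma' : Set ℕ} {Γ : Type*} [Group Γ]
  {P : Type u} [Group P] [TopologicalSpace P] [IsTopologicalGroup P] [CompactSpace P]
  [TotallyDisconnectedSpace P]
  {D : Type u} [Group D] [TopologicalSpace D] [IsTopologicalGroup D] [CompactSpace D] [T2Space D]
  [TotallyDisconnectedSpace D]
  {j : Γ →* P} {π : P →* D} {U : Subgroup P} {g r : ℕ}

omit [TopologicalSpace P] [IsTopologicalGroup P] [CompactSpace P] [TotallyDisconnectedSpace P]
  [TopologicalSpace D] [IsTopologicalGroup D] [CompactSpace D] [T2Space D] [TotallyDisconnectedSpace D] in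
/-- At the GFG data, `j⁻¹U = (π U).comap (π ∘ j)` (since `ker π ≤ U`).
[cite: MochizukiAbsTopI2012, Def 2.1 (i) p.17] -/
theorem comap_comp_eq_comap (hker : π.ker ≤ U) :
    (U.map π).comap (π.comp j) = U.comap j := by
  ext γ
  simp only [Subgroup.mem_comap, MonoidHom.coe_comp, Function.comp_apply]
  constructor
  · rintro ⟨u, hu, hue⟩
    have : u⁻¹ * j γ ∈ π.ker := by
      rw [MonoidHom.mem_ker, map_mul, map_inv, hue, inv_mul_cancel]
    have h2 := U.mul_mem hu (hker this)
    rwa [mul_inv_cancel_left] at h2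
  · exact fun h => ⟨j γ, h, rfl⟩

/-- **(H_ab) at the GFG construction from (HOM).**  `P` profinite, `j : Γ → P` a pro-`Σ′` completion of an
ARBITRARY discrete `Γ`, `U ⊴ P` open with `e : j⁻¹U ≃* Γ_{g,r}` hyperbolic, `π : P ↠ D` continuous with
`ker π ≤ U` presenting the maximal pro-`Σ` quotient on `U` (`Σ ⊆ Σ′` nonempty sets of primes).  IF (HOM)
every `γ ∈ Γ ∖ j⁻¹U` moves a class of `H₁(j⁻¹U, ℤ)` (`∃ h ∈ j⁻¹U, γhγ⁻¹h⁻¹ ∉ [j⁻¹U, j⁻¹U]`), THEN every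
`x ∈ D ∖ π(U)` moves a class of `π(U)/closure[π(U), π(U)]`.
[cite: MochizukiAbsTopI2012, Prop 2.3 (i) p.19] -/
theorem forall_exists_conj_not_mem_closure_commutator_of_homological (hSS : Sigma ⊆ Sigma')
    (hS : Sigma.Nonempty) (hSp : ∀ p ∈ Sigma, p.Prime) (hj : IsProSigmaCompletion Sigma' j)
    [hUn : U.Normal] (hUo : IsOpen (U : Set P)) (hgr : PuncturedSurfaceGroup.IsHyperbolicType g r)
    (e : U.comap j ≃* PuncturedSurfaceGroup g r) (hπc : Continuous π) (hπs : Function.Surjective π)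
    (hker : π.ker ≤ U) (hmax : IsMaxProSigmaQuotient Sigma (π.subgroupMap U))
    (hHom : ∀ γ : Γ, γ ∉ U.comap j → ∃ h ∈ U.comap j, γ * h * γ⁻¹ * h⁻¹ ∉ ⁅U.comap j, U.comap j⁆) :
    ∀ x : D, x ∉ U.map π → ∃ y ∈ U.map π,
      x * y * x⁻¹ * y⁻¹ ∉ ((⁅U.map π, U.map π⁆ : Subgroup D)).topologicalClosure := by
  classical
  haveI hUbn : (U.map π).Normal := hUn.map π hπs
  have hUbo : IsOpen ((U.map π : Subgroup D) : Set D) := isOpen_map hUo hπc hπs hker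
  -- the completion `j⁻¹U → π(U)` re-based on `(π U).comap (π ∘ j) = j⁻¹U`
  have hcomp := isProSigmaCompletion_map hSS hj hUo hπc hmax
  have heq : (U.map π).comap (π.comp j) = U.comap j := comap_comp_eq_comap hker
  have hU' : IsProSigmaCompletion Sigma ((π.comp j).subgroupComap (U.map π)) := by
    refine IsProSigmaCompletion.of_comp_mulEquiv (MulEquiv.subgroupCongr heq) (fun x => ?_) hcomp
    rfl
  -- density of `π ∘ j`
  have hdense : Dense (Set.range (π.comp j)) := by
    have h : DenseRange (π ∘ j) := hπs.denseRange.comp hj.dense hπc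
    exact h
  refine forall_exists_conj_not_mem_closure_commutator_of_denseRange hdense (U.map π) hUbo hU' ?_
  -- (HOM) on `j⁻¹U`, transported to `(π U).comap (π ∘ j)` and read through a character to `ℤ/p^e`
  intro l hl
  rw [heq] at hl
  obtain ⟨h, hh, hw⟩ := hHom l hl
  obtain ⟨p, hpS⟩ := hS
  have hp : p.Prime := hSp p hpS
  -- the abelianisation of `j⁻¹U ≅ Γ_{g,r}` is free abelian of finite rank
  haveI : (⊤ : Subgroup (PuncturedSurfaceGroup g r)).FiniteIndex := ⟨by rw [Subgroup.index_top]; exact one_ne_zero⟩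
  obtain ⟨n, ⟨L⟩⟩ := PuncturedSurfaceGroup.exists_linearEquiv_abelianization_of_finiteIndex hgr ⊤
  let eT : U.comap j ≃* (⊤ : Subgroup (PuncturedSurfaceGroup g r)) := e.trans Subgroup.topEquiv.symm
  let L' : Additive (Abelianization (U.comap j)) ≃ₗ[ℤ] (Fin n → ℤ) :=
    (MulEquiv.toAdditive eT.abelianizationCongr).toIntLinearEquiv.trans L
  have hlh : l * h * l⁻¹ ∈ U.comap j := (hUn.comap j).conj_mem _ hh l
  set w : U.comap j := ⟨l * h * l⁻¹, hlh⟩ * ⟨h, hh⟩⁻¹ with hwdef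
  have hw' : w ∉ commutator (U.comap j) := by
    rw [mem_commutator_iff_coe_mem]
    exact hw
  obtain ⟨k, χ, hk, hχ⟩ := exists_character_zmod_primePow_ne_one L' w hw' p hp
  have hint : IsSigmaInteger Sigma (p ^ k) :=
    ⟨pow_pos hp.pos k, fun q hq hqd => by
      rwa [(Nat.prime_dvd_prime_iff_eq hq hp).mp (hq.dvd_of_dvd_pow hqd)]⟩
  -- transport `χ` to the re-based subgroup
  let ι : (U.map π).comap (π.comp j) →* U.comap j := (MulEquiv.subgroupCongr heq).toMonoidHom
  refine ⟨p ^ k, χ.comp ι, ⟨h, by rw [heq]; exact hh⟩, hint, fun heqχ => hχ ?_⟩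
  rw [hwdef, map_mul, map_inv, mul_inv_eq_one]
  exact heqχ

/-- **(T1) from (HOM): `Z_D(π U) = 1`** — the deck group `D/π(U) = Gal(Y/X)` acts outer-faithfully on
`U^Σ` — at the GFG construction with an arbitrary lattice `Γ` (`j⁻¹U ≅ Γ_{g,r}` hyperbolic), granted
(HOM). [cite: MochizukiAbsTopI2012, Prop 2.3 (i) p.19] -/
theorem centralizer_map_eq_bot_of_homological (hSS : Sigma ⊆ Sigma')
    (hS : Sigma.Nonempty) (hSp : ∀ p ∈ Sigma, p.Prime) (hj : IsProSigmaCompletion Sigma' j)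
    [hUn : U.Normal] (hUo : IsOpen (U : Set P)) (hgr : PuncturedSurfaceGroup.IsHyperbolicType g r)
    (e : U.comap j ≃* PuncturedSurfaceGroup g r) (hπc : Continuous π) (hπs : Function.Surjective π)
    (hker : π.ker ≤ U) (hmax : IsMaxProSigmaQuotient Sigma (π.subgroupMap U))
    (hHom : ∀ γ : Γ, γ ∉ U.comap j → ∃ h ∈ U.comap j, γ * h * γ⁻¹ * h⁻¹ ∉ ⁅U.comap j, U.comap j⁆) :
    Subgroup.centralizer ((U.map π : Subgroup D) : Set D) = ⊥ := by
  haveI hUbn : (U.map π).Normal := hUn.map π hπs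
  have hUbo : IsOpen ((U.map π : Subgroup D) : Set D) := isOpen_map hUo hπc hπs hker
  have hι : IsProSigmaCompletion Sigma
      (((π.subgroupMap U).comp (j.subgroupComap U)).comp e.symm.toMonoidHom) :=
    IsProSigmaCompletion.of_comp_mulEquiv e.symm (fun _ => rfl) (isProSigmaCompletion_map hSS hj hUo hπc hmax)
  have hZ : Subgroup.centralizer ((⊤ : Subgroup (U.map π)) : Set (U.map π)) = ⊥ :=
    centralizer_top_eq_bot_of_isOpen_proSigma_hyperbolic hS hSp hgr (U.map π) hUbo _ hι
  exact (centralizer_eq_bot_iff_mem_of_conj_eq_conj (U.map π) hZ).mpr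
    (outerFaithful_of_forall_exists_conj_not_mem_closure_commutator (U.map π)
      (forall_exists_conj_not_mem_closure_commutator_of_homological hSS hS hSp hj hUo hgr e hπc hπs
        hker hmax hHom))

/-- **(T3) from (HOM)**: `D` has no nontrivial finite normal subgroup. [cite: MochizukiAbsTopI2012, Prop 2.3 (i) p.19] -/
theorem forall_finite_normal_eq_bot_of_homological (hSS : Sigma ⊆ Sigma')
    (hS : Sigma.Nonempty) (hSp : ∀ p ∈ Sigma, p.Prime) (hj : IsProSigmaCompletion Sigma' j)
    [hUn : U.Normal] (hUo : IsOpen (U : Set P)) (hgr : PuncturedSurfaceGroup.IsHyperbolicType g r)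
    (e : U.comap j ≃* PuncturedSurfaceGroup g r) (hπc : Continuous π) (hπs : Function.Surjective π)
    (hker : π.ker ≤ U) (hmax : IsMaxProSigmaQuotient Sigma (π.subgroupMap U))
    (hHom : ∀ γ : Γ, γ ∉ U.comap j → ∃ h ∈ U.comap j, γ * h * γ⁻¹ * h⁻¹ ∉ ⁅U.comap j, U.comap j⁆) :
    ∀ N : Subgroup D, N.Normal → (N : Set D).Finite → N = ⊥ := by
  haveI hUbn : (U.map π).Normal := hUn.map π hπs
  have hUbo : IsOpen ((U.map π : Subgroup D) : Set D) := isOpen_map hUo hπc hπs hker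
  have hι : IsProSigmaCompletion Sigma
      (((π.subgroupMap U).comp (j.subgroupComap U)).comp e.symm.toMonoidHom) :=
    IsProSigmaCompletion.of_comp_mulEquiv e.symm (fun _ => rfl) (isProSigmaCompletion_map hSS hj hUo hπc hmax)
  exact (forall_finite_normal_eq_bot_iff_outerFaithful hS hSp hgr (U.map π) hUbo _ hι).mpr
    (outerFaithful_of_forall_exists_conj_not_mem_closure_commutator (U.map π)
      (forall_exists_conj_not_mem_closure_commutator_of_homological hSS hS hSp hj hUo hgr e hπc hπs
        hker hmax hHom))

/-- **(T4) from (HOM)**: `D` is slim and elastic — [AbsTopI] Prop 2.3 (i) at the Def 2.1 (i) construction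
with an arbitrary (e.g. Fuchsian) lattice, modulo (HOM) only. [cite: MochizukiAbsTopI2012, Prop 2.3 (i) p.19] -/
theorem slim_and_elastic_of_homological (hSS : Sigma ⊆ Sigma')
    (hS : Sigma.Nonempty) (hSp : ∀ p ∈ Sigma, p.Prime) (hj : IsProSigmaCompletion Sigma' j)
    [hUn : U.Normal] (hUo : IsOpen (U : Set P)) (hgr : PuncturedSurfaceGroup.IsHyperbolicType g r)
    (e : U.comap j ≃* PuncturedSurfaceGroup g r) (hπc : Continuous π) (hπs : Function.Surjective π)
    (hker : π.ker ≤ U) (hmax : IsMaxProSigmaQuotient Sigma (π.subgroupMap U))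
    (hHom : ∀ γ : Γ, γ ∉ U.comap j → ∃ h ∈ U.comap j, γ * h * γ⁻¹ * h⁻¹ ∉ ⁅U.comap j, U.comap j⁆) :
    IsSlimGroup D ∧ IsElastic D := by
  haveI hUbn : (U.map π).Normal := hUn.map π hπs
  have hUbo : IsOpen ((U.map π : Subgroup D) : Set D) := isOpen_map hUo hπc hπs hker
  have hι : IsProSigmaCompletion Sigma
      (((π.subgroupMap U).comp (j.subgroupComap U)).comp e.symm.toMonoidHom) :=
    IsProSigmaCompletion.of_comp_mulEquiv e.symm (fun _ => rfl) (isProSigmaCompletion_map hSS hj hUo hπc hmax)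
  exact slim_and_elastic_of_isOpen_proSigma_hyperbolic_of_outerFaithful' hS hSp hgr (U.map π) hUbo _ hι
    (outerFaithful_of_forall_exists_conj_not_mem_closure_commutator (U.map π)
      (forall_exists_conj_not_mem_closure_commutator_of_homological hSS hS hSp hj hUo hgr e hπc hπs
        hker hmax hHom))

/-! ### The curve case: (HOM) is a theorem for surface-group lattices -/

/-- **CURVE case, second route**: at the Def 2.1 (i) construction with lattice `Γ = Γ_{g₀,r₀}` hyperbolic
(proper `r₀ = 0` and affine alike), (HOM) is the THEOREM
`PuncturedSurfaceGroup.exists_conj_not_mem_commutator`, so **`Z_D(π U) = 1`, no finite normal subgroups,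
`D` slim and elastic** hold outright — an independent route to abc-iut-w6-d030's p440186 / abc-iut-w6-d071's
p443001. [cite: MochizukiAbsTopI2012, Prop 2.3 (i) p.19] -/
theorem slim_and_elastic_of_puncturedSurfaceGroup_lattice {g₀ r₀ : ℕ}
    {j : PuncturedSurfaceGroup g₀ r₀ →* P} {U : Subgroup P} (hSS : Sigma ⊆ Sigma')
    (hS : Sigma.Nonempty) (hSp : ∀ p ∈ Sigma, p.Prime) (hgr₀ : PuncturedSurfaceGroup.IsHyperbolicType g₀ r₀)
    (hj : IsProSigmaCompletion Sigma' j) [hUn : U.Normal] (hUo : IsOpen (U : Set P)) (hπc : Continuous π)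
    (hπs : Function.Surjective π) (hker : π.ker ≤ U) (hmax : IsMaxProSigmaQuotient Sigma (π.subgroupMap U)) :
    Subgroup.centralizer ((U.map π : Subgroup D) : Set D) = ⊥ ∧
      (∀ N : Subgroup D, N.Normal → (N : Set D).Finite → N = ⊥) ∧ IsSlimGroup D ∧ IsElastic D := by
  -- `j⁻¹U` is a finite-index normal subgroup of `Γ_{g₀,r₀}`, hence `≅ Γ_{g,r}` hyperbolic
  haveI : (U.comap j).FiniteIndex := finiteIndex_comap hj U hUo
  obtain ⟨g, r, θ, -, -, hgr, hθ, hrange, -⟩ :=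
    puncturedSurfaceGroupFiniteIndexSubgroup_holds g₀ r₀ hgr₀ (U.comap j) inferInstance
  let e : U.comap j ≃* PuncturedSurfaceGroup g r :=
    ((MonoidHom.ofInjective hθ).trans (MulEquiv.subgroupCongr hrange)).symm
  -- (HOM) is a theorem here
  have hHom : ∀ γ : PuncturedSurfaceGroup g₀ r₀, γ ∉ U.comap j →
      ∃ h ∈ U.comap j, γ * h * γ⁻¹ * h⁻¹ ∉ ⁅U.comap j, U.comap j⁆ := fun γ hγ =>
    PuncturedSurfaceGroup.exists_conj_not_mem_commutator hgr₀ (U.comap j) γ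
      (by
        haveI := hUn.comap j
        rw [Subgroup.normalizer_eq_top]
        exact Subgroup.mem_top γ) hγ
  exact ⟨centralizer_map_eq_bot_of_homological hSS hS hSp hj hUo hgr e hπc hπs hker hmax hHom,
    forall_finite_normal_eq_bot_of_homological hSS hS hSp hj hUo hgr e hπc hπs hker hmax hHom,
    slim_and_elastic_of_homological hSS hS hSp hj hUo hgr e hπc hπs hker hmax hHom⟩

end GFGSurfaceModel

/-! ### The index-two inversion model as a special case -/

section IndexTwoInv

variable {Δ : Type u} [Group Δ] [TopologicalSpace Δ] [IsTopologicalGroup Δ] [CompactSpace Δ]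
  [TotallyDisconnectedSpace Δ] {Sigma : Set ℕ} {g r : ℕ}

/-- At the index-two inversion model of this lineage (`N ⊆ Δ` open, a pro-`Σ` completion of a hyperbolic
`Γ_{g,r}`, every `z ∈ Δ ∖ N` acting on `N^{ab}` by `−1`), EVERY `z ∉ N` moves a class of `N/closure[N,N]`:
`z x⁻¹ z⁻¹ x ≡ x²` and some square lies outside `closure[N,N]` (p437009). [cite: MochizukiAbsTopI2012, Prop 2.3 (i) p.19] -/
theorem forall_exists_conj_not_mem_closure_commutator_of_indexTwoInv (N : Subgroup Δ)
    (hNo : IsOpen (N : Set Δ)) (hS : Sigma.Nonempty) (hSp : ∀ p ∈ Sigma, p.Prime)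
    (hgr : PuncturedSurfaceGroup.IsHyperbolicType g r) (ι : PuncturedSurfaceGroup g r →* N)
    (hι : IsProSigmaCompletion Sigma ι)
    (hinv : ∀ z : Δ, z ∉ N → ∀ x ∈ N, z * x * z⁻¹ * x ∈ (⁅N, N⁆ : Subgroup Δ).topologicalClosure) :
    ∀ z : Δ, z ∉ N → ∃ y ∈ N, z * y * z⁻¹ * y⁻¹ ∉ ((⁅N, N⁆ : Subgroup Δ)).topologicalClosure := by
  intro z hz
  haveI : CompactSpace N := Literature.GroupTheory.ProfiniteSubquotients.compactSpace_of_isOpen hNo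
  obtain ⟨x, hx⟩ := IsProSigmaCompletion.exists_mul_self_not_mem_topologicalClosure_commutator hι hS hSp hgr
  refine ⟨(x : Δ)⁻¹, N.inv_mem x.2, fun hmem => hx ?_⟩
  -- `z x⁻¹ z⁻¹ x = (z x⁻¹ z⁻¹ x⁻¹) · x²`, and `z x⁻¹ z⁻¹ x⁻¹ ∈ closure[N,N]` by the inversion hypothesis
  have h1 := hinv z hz _ (N.inv_mem x.2)
  rw [inv_inv] at hmem
  have h2 : (x : Δ) * x = (z * (x : Δ)⁻¹ * z⁻¹ * (x : Δ)⁻¹)⁻¹ * (z * (x : Δ)⁻¹ * z⁻¹ * x) := by group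
  rw [mem_topologicalClosure_commutator_iff, Subgroup.coe_mul, h2]
  exact Subgroup.mul_mem _ (Subgroup.inv_mem _ h1) hmem

/-- **(OF) at the index-two inversion model**: with the data above, an element of `Δ` acting on `N` as an
inner automorphism of `N` lies in `N` (`Δ/N ↪ Out N`) — the by-name sequel asked of this lineage.
[cite: MochizukiAbsTopI2012, Prop 2.3 (i) p.19] -/
theorem outerFaithful_of_indexTwoInv (N : Subgroup Δ) (hNo : IsOpen (N : Set Δ))
    (hS : Sigma.Nonempty) (hSp : ∀ p ∈ Sigma, p.Prime)
    (hgr : PuncturedSurfaceGroup.IsHyperbolicType g r) (ι : PuncturedSurfaceGroup g r →* N)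
    (hι : IsProSigmaCompletion Sigma ι)
    (hinv : ∀ z : Δ, z ∉ N → ∀ x ∈ N, z * x * z⁻¹ * x ∈ (⁅N, N⁆ : Subgroup Δ).topologicalClosure) :
    ∀ x : Δ, (∃ u ∈ N, ∀ y ∈ N, x * y * x⁻¹ = u * y * u⁻¹) → x ∈ N :=
  outerFaithful_of_forall_exists_conj_not_mem_closure_commutator N
    (forall_exists_conj_not_mem_closure_commutator_of_indexTwoInv N hNo hS hSp hgr ι hι hinv)

end IndexTwoInv

end Literature.AnabelianGeometry.AbsoluteAnabelian

end
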